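import Summits.QuantumAdvantage.QuantumAdvantage.Theorems.NearExactIsExact.Negative.MmFormDichotomy
import Summits.QuantumAdvantage.QuantumAdvantage.Theorems.NearExactIsExact.Negative.BqqEightNineTen
import Summits.QuantumAdvantage.QuantumAdvantage.Theorems.NearExactIsExact.Negative.BqqNineTen
import Summits.QuantumAdvantage.QuantumAdvantage.Theorems.ExactPairsMaioranaMcFarland.Negative.DillonCertificate

/-!
# `NearExactIsExact` (stmt-QuantumAdvantage-14043) — the one-sided Maiorana–McFarland gap: non-injective `π`
  never beats `15/16` (all `n`), and for `n = 16, 18, 20` every cubic `f` against every `g` in biquadratic MM sign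
  form has `Φ = 1 ∨ Φ ≤ 15/16`

DISPROOF §10.4, PROPOSITION (MM gap, paper): "no Maiorana–McFarland-shaped cubic pair on `n = 2s ≤ 20` bits has
`Φ ∈ (15/16, 1)`". Kernel-checked here by combining `MmFormDichotomy.mmForm_gap_of_bqq` (any cubic `f`, `g` in MM
sign form over a coordinatewise quadratic `π : 𝔽₂ᵐ → 𝔽₂ᵐ` with cubic dual word `h`: BQQ(m) ⇒ `Φ = 1 ∨ Φ ≤ 15/16`)
with the window theorems `BqqEightNineTen.bqq_eight` (`m = 8`, residual weight `0` or `≥ 8`), `BqqNineTen.bqq_nine`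
(`m = 9`, `0` or `≥ 16`) and `BqqNineTen.bqq_ten` (`m = 10`, `0` or `≥ 32`); `m = 7` is
`MmFormDichotomy.mmForm_gap_fourteen`. UNIFORM IN `n` (`mmForm_le_of_not_injective`): if `π` is not injective
(the non-bent MM sign forms) then `Φ ≤ 15/16` against every cubic `f`, for every `m` — the second branch of the
dichotomy provides a left inverse of `π`. The bound `15/16` is attained in this habitat at `n = 16`
(`Negative/FifteenSixteenths`, `BqqEightFifteenSixteenths`) and `n = 20` (`PentagonFifteenSixteenths`), so for
`n ∈ {16, 20}` the supremum of the non-exact values of the habitat is exactly `15/16`.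

HONEST FRAMING: THEOREMS about the finite slices `n = 16, 18, 20` of ONE habitat (one side in MM sign form over a
quadratic map; the other side an arbitrary cubic) — NOT summit progress: no violation of `NearExactIsExact`, no new
per-`n` value; whether cubic pairs outside this habitat beat `15/16` (they do not up to `n = 10`; open from `n = 12`)
is untouched. Everything used is proved in the tree; standard axioms.
-/

set_option linter.dupNamespace false -- D-0017: single-problem summit ⇒ `QuantumAdvantage.QuantumAdvantage` by design

noncomputable section

namespace Summit.QuantumAdvantage.QuantumAdvantage.Theorems.NearExactIsExact.Negative.MmFormGap

open Finset
open Literature.Computability.QuantumComplexity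
open Summit.QuantumAdvantage.QuantumAdvantage.Theorems.NearExactIsExact.Negative.MmFormDichotomy
  (mmForm_dichotomy mmForm_gap_of_bqq)
open Summit.QuantumAdvantage.QuantumAdvantage.Theorems.NearExactIsExact.Negative.BqqEightNineTen (bqq_eight)
open Summit.QuantumAdvantage.QuantumAdvantage.Theorems.NearExactIsExact.Negative.BqqNineTen (bqq_nine bqq_ten)
open Summit.QuantumAdvantage.QuantumAdvantage.Theorems.ExactPairsMaioranaMcFarland.Negative (forrelation_comm)

/-- **Non-injective quadratic maps never beat `15/16` (all `n`).** For every `m`, every cubic `f` on `m + m` bits and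
every `g` in Maiorana–McFarland sign form over a coordinatewise quadratic `π : 𝔽₂ᵐ → 𝔽₂ᵐ` that is NOT injective
(dual word `h` arbitrary): `Φ(f,g) ≤ 15/16` — the other branch of `mmForm_dichotomy` gives `π` a left inverse.
(The value `15/16` itself is attained with non-injective `π` at `n = 16`: `Negative/FifteenSixteenths`.) [this work] -/
theorem mmForm_le_of_not_injective {m : ℕ} (f g : (Fin (m + m) → Bool) → Bool)
    (π : (Fin m → Bool) → (Fin m → Bool)) (h : (Fin m → Bool) → Bool) (hf : IsDegLeFun 3 f)
    (hπ : ∀ i : Fin m, IsDegLeFun 2 (fun y => π y i)) (hninj : ¬ Function.Injective π)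
    (hg : ∀ y₁ y₂ : Fin m → Bool, signOf (g (Fin.append y₁ y₂)) = twist y₁ (π y₂) * signOf (h y₂)) :
    forrelation f g ≤ 15 / 16 := by
  rcases mmForm_dichotomy f g π h hf hπ hg with hle | ⟨τ, -, hτπ, -⟩
  · exact hle
  · exact absurd (fun a b hab => by rw [← hτπ a, ← hτπ b, hab]) hninj

/-- **One-sided MM gap at `n = 16`.** Every cubic `f` and every `g` in Maiorana–McFarland sign form over a
coordinatewise quadratic `π : 𝔽₂⁸ → 𝔽₂⁸` with cubic dual word `h`: `Φ(f,g) = 1 ∨ Φ(f,g) ≤ 15/16`. Sharp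
(`BqqEightFifteenSixteenths.forrelation_f16b_g16b`). [this work] -/
theorem mmForm_gap_sixteen (f g : (Fin (8 + 8) → Bool) → Bool) (π : (Fin 8 → Bool) → (Fin 8 → Bool))
    (h : (Fin 8 → Bool) → Bool) (hf : IsDegLeFun 3 f) (hπ : ∀ i : Fin 8, IsDegLeFun 2 (fun y => π y i))
    (hh : IsDegLeFun 3 h)
    (hg : ∀ y₁ y₂ : Fin 8 → Bool, signOf (g (Fin.append y₁ y₂)) = twist y₁ (π y₂) * signOf (h y₂)) :
    forrelation f g = 1 ∨ forrelation f g ≤ 15 / 16 :=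
  mmForm_gap_of_bqq (fun π τ hπ hτ hτπ c₁ c₂ h₁ h₂ =>
    (bqq_eight π τ hπ hτ hτπ c₁ c₂ h₁ h₂).imp_right fun hw => by simp only [Nat.reducePow]; omega)
    f g π h hf hπ hh hg

/-- **One-sided MM gap at `n = 18`.** Same statement over `π : 𝔽₂⁹ → 𝔽₂⁹` (`BqqNineTen.bqq_nine`). [this work] -/
theorem mmForm_gap_eighteen (f g : (Fin (9 + 9) → Bool) → Bool) (π : (Fin 9 → Bool) → (Fin 9 → Bool))
    (h : (Fin 9 → Bool) → Bool) (hf : IsDegLeFun 3 f) (hπ : ∀ i : Fin 9, IsDegLeFun 2 (fun y => π y i))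
    (hh : IsDegLeFun 3 h)
    (hg : ∀ y₁ y₂ : Fin 9 → Bool, signOf (g (Fin.append y₁ y₂)) = twist y₁ (π y₂) * signOf (h y₂)) :
    forrelation f g = 1 ∨ forrelation f g ≤ 15 / 16 :=
  mmForm_gap_of_bqq (fun π τ hπ hτ hτπ c₁ c₂ h₁ h₂ =>
    (bqq_nine π τ hπ hτ hτπ c₁ c₂ h₁ h₂).imp_right fun hw => by simp only [Nat.reducePow]; omega)
    f g π h hf hπ hh hg

/-- **One-sided MM gap at `n = 20`.** Same statement over `π : 𝔽₂¹⁰ → 𝔽₂¹⁰` (`BqqNineTen.bqq_ten`). Sharp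
(`PentagonFifteenSixteenths.exists_bijectiveMm_pair_fifteen_sixteenths`). [this work] -/
theorem mmForm_gap_twenty (f g : (Fin (10 + 10) → Bool) → Bool) (π : (Fin 10 → Bool) → (Fin 10 → Bool))
    (h : (Fin 10 → Bool) → Bool) (hf : IsDegLeFun 3 f) (hπ : ∀ i : Fin 10, IsDegLeFun 2 (fun y => π y i))
    (hh : IsDegLeFun 3 h)
    (hg : ∀ y₁ y₂ : Fin 10 → Bool, signOf (g (Fin.append y₁ y₂)) = twist y₁ (π y₂) * signOf (h y₂)) :
    forrelation f g = 1 ∨ forrelation f g ≤ 15 / 16 :=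
  mmForm_gap_of_bqq (fun π τ hπ hτ hτπ c₁ c₂ h₁ h₂ =>
    (bqq_ten π τ hπ hτ hτπ c₁ c₂ h₁ h₂).imp_right fun hw => by simp only [Nat.reducePow]; omega)
    f g π h hf hπ hh hg

/-- By the symmetry `Φ(f,g) = Φ(g,f)` every statement of this file also holds with the rôles swapped (the MM sign
form on the `f` side, the arbitrary cubic on the `g` side): at `n ≤ 20` a cubic pair with `Φ ∈ (15/16, 1)` has
NEITHER side in Maiorana–McFarland sign form over a coordinatewise quadratic map. [folklore] -/
theorem gap_swap {n : ℕ} (f g : (Fin n → Bool) → Bool) (hgf : forrelation g f = 1 ∨ forrelation g f ≤ 15 / 16) :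
    forrelation f g = 1 ∨ forrelation f g ≤ 15 / 16 := by
  rwa [forrelation_comm f g]

end Summit.QuantumAdvantage.QuantumAdvantage.Theorems.NearExactIsExact.Negative.MmFormGap

end
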